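import Mathlib
import Literature.NumberTheory.Sieve.RoughOmegaCells
import Summits.Parity.GeneralizedHardyLittlewood.Theorems.ParityLeakOneFifthPlainSplitCalibReductionDivisors
import HarnessLib

/-!
# Route ParityLeakOneFifth, crux `PlainSplit` (stmt-Parity-18382), skeleton `calib-split`:
# tools for stub `stub_calibReduction`, II — the pointwise inequality

For a `y`-rough `m ≥ 2` with `Ω(m) ≤ 5`, `1 ≤ D < y³`, `D² < m`, and the size conditions
"`Ω(m) = 4 ⇒` every prime factor `≤ D`", "`Ω(m) = 5 ⇒` every semiprime divisor `≤ D`":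
`−λ(m)·Σ_{d ∣ m, d ≤ D} μ(d) ≥ 1[m prime] − 1[D < P⁻(m), Ω(m) = 2] − 2·1[Ω(m) = 3] − 32·1[m not squarefree]`
(`negLiouville_truncMoebius_ge`; squarefree cases from part I, `|Σ| ≤ 2^Ω ≤ 32` otherwise), plus the
two size lemmas discharging those conditions inside the window (`cardFactors_le_five_of_rough`,
`le_of_cofactor_three`).
-/

namespace Summit.Parity.GeneralizedHardyLittlewood.Theorems.ParityLeakOneFifth

open Finset
open scoped ArithmeticFunction.Omega ArithmeticFunction.Moebius
open Literature.NumberTheory.Sieve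
/-! ### The pointwise inequality -/

/-- `Ω d ≤ Ω m` for `d ∣ m`, `m ≠ 0`. -/
theorem cardFactors_le_of_dvd {d m : ℕ} (hm0 : m ≠ 0) (hd : d ∣ m) : Ω d ≤ Ω m := by
  obtain ⟨k, rfl⟩ := hd
  rw [ArithmeticFunction.cardFactors_mul (left_ne_zero_of_mul hm0) (right_ne_zero_of_mul hm0)]
  omega

/-- `|Σ_{d ∣ m, d ≤ D} μ(d)| ≤ 2 ^ Ω(m)` (the squarefree divisors inject into the subsets of the
prime factors, and `ω ≤ Ω`). -/
theorem abs_truncMoebius_le {m : ℕ} (hm0 : m ≠ 0) (D : ℝ) :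
    |∑ d ∈ (Nat.divisors m).filter (fun d : ℕ => (d : ℝ) ≤ D), (μ d : ℝ)| ≤ (2 : ℝ) ^ Ω m := by
  have h1 : |∑ d ∈ (Nat.divisors m).filter (fun d : ℕ => (d : ℝ) ≤ D), (μ d : ℝ)| ≤
      ∑ d ∈ (Nat.divisors m).filter (fun d : ℕ => (d : ℝ) ≤ D), |(μ d : ℝ)| :=
    Finset.abs_sum_le_sum_abs _ _
  have h2 : ∑ d ∈ (Nat.divisors m).filter (fun d : ℕ => (d : ℝ) ≤ D), |(μ d : ℝ)| ≤
      ∑ d ∈ (Nat.divisors m).filter (fun d : ℕ => Squarefree d), (1 : ℝ) := by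
    set F := (Nat.divisors m).filter (fun d : ℕ => (d : ℝ) ≤ D) with hF
    have hz : ∑ d ∈ F.filter (fun d : ℕ => ¬ Squarefree d), |(μ d : ℝ)| = 0 := by
      refine Finset.sum_eq_zero fun d hd => ?_
      rw [Finset.mem_filter] at hd
      simp [ArithmeticFunction.moebius_eq_zero_of_not_squarefree hd.2]
    calc ∑ d ∈ F, |(μ d : ℝ)| = ∑ d ∈ F.filter (fun d : ℕ => Squarefree d), |(μ d : ℝ)| := by
          rw [← Finset.sum_filter_add_sum_filter_not F (fun d : ℕ => Squarefree d), hz, add_zero]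
      _ ≤ ∑ d ∈ F.filter (fun d : ℕ => Squarefree d), (1 : ℝ) := by
          refine Finset.sum_le_sum fun d hd => ?_
          rw [Finset.mem_filter] at hd
          rw [ArithmeticFunction.moebius_apply_of_squarefree hd.2]
          simp
      _ ≤ ∑ d ∈ (Nat.divisors m).filter (fun d : ℕ => Squarefree d), (1 : ℝ) := by
          refine Finset.sum_le_sum_of_subset_of_nonneg ?_ (fun _ _ _ => zero_le_one)
          intro d hd
          rw [Finset.mem_filter] at hd ⊢
          exact ⟨(Finset.mem_filter.1 hd.1).1, hd.2⟩
  have h3 : ∑ d ∈ (Nat.divisors m).filter (fun d : ℕ => Squarefree d), (1 : ℝ) ≤ (2 : ℝ) ^ Ω m := by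
    rw [Finset.sum_const, nsmul_eq_mul, mul_one]
    have hcard : #((Nat.divisors m).filter (fun d : ℕ => Squarefree d)) ≤ 2 ^ #m.primeFactors := by
      rw [← Finset.card_powerset]
      refine Finset.card_le_card_of_injOn (fun d => d.primeFactors) ?_ ?_
      · intro d hd
        rw [Finset.mem_coe, Finset.mem_filter] at hd
        rw [Finset.mem_coe, Finset.mem_powerset]
        exact Nat.primeFactors_mono (Nat.dvd_of_mem_divisors hd.1) hm0
      · intro d₁ hd₁ d₂ hd₂ h
        rw [Finset.mem_coe, Finset.mem_filter] at hd₁ hd₂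
        have h1 := Nat.prod_primeFactors_of_squarefree hd₁.2
        have h2 := Nat.prod_primeFactors_of_squarefree hd₂.2
        rw [← h1, ← h2]; simp only at h; rw [h]
    have hω : #m.primeFactors ≤ Ω m := by
      rw [Nat.primeFactors, ArithmeticFunction.cardFactors_apply]
      exact (List.toFinset_card_le _)
    calc (#((Nat.divisors m).filter (fun d : ℕ => Squarefree d)) : ℝ) ≤ ((2 ^ #m.primeFactors : ℕ) : ℝ) := by
          exact_mod_cast hcard
      _ ≤ ((2 ^ Ω m : ℕ) : ℝ) := by exact_mod_cast Nat.pow_le_pow_right two_pos hω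
      _ = (2 : ℝ) ^ Ω m := by push_cast; ring
  exact h1.trans (h2.trans h3)

/-- **Pointwise inequality** for the truncated Möbius sum on a `y`-rough `m ≥ 2` with `Ω m ≤ 5`,
`D ≥ 1`, `D < y³`, `D² < m`, and the size conditions "`Ω m = 4` ⇒ all prime factors `≤ D`",
"`Ω m = 5` ⇒ all semiprime divisors `≤ D`":
`−λ(m)·G(m) ≥ 1[m prime] − 1[D < minFac m ∧ Ω m = 2] − 2·1[Ω m = 3] − 32·1[¬ squarefree m]`. -/
theorem negLiouville_truncMoebius_ge {m : ℕ} {y D : ℝ} (hm2 : 2 ≤ m) (hy : 1 ≤ y) (hD1 : 1 ≤ D)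
    (hDy : D < y ^ 3) (hDm : D ^ 2 < m) (hr : ∀ p ∈ m.primeFactors, y ≤ (p : ℝ)) (hΩ5 : Ω m ≤ 5)
    (h4 : Ω m = 4 → ∀ p ∈ m.primeFactors, (p : ℝ) ≤ D)
    (h5 : Ω m = 5 → ∀ d ∈ Nat.divisors m, Ω d = 2 → (d : ℝ) ≤ D) :
    (if m.Prime then (1 : ℝ) else 0) - (if D < (m.minFac : ℝ) ∧ Ω m = 2 then 1 else 0) -
        2 * (if Ω m = 3 then 1 else 0) - 32 * (if ¬ Squarefree m then 1 else 0) ≤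
      -(ArithmeticFunction.liouville m : ℝ) *
        ∑ d ∈ (Nat.divisors m).filter (fun d : ℕ => (d : ℝ) ≤ D), (μ d : ℝ) := by
  have hm0 : m ≠ 0 := by omega
  have hDm' : D < m := by nlinarith
  have hlam : (ArithmeticFunction.liouville m : ℝ) = (-1) ^ Ω m := by
    rw [ArithmeticFunction.liouville_apply hm0]; push_cast; ring
  by_cases hsq : Squarefree m
  · -- squarefree: `G = 1 − s₁ + s₂`
    rw [truncMoebius_eq hy hDy hD1 hsq hr, hlam, if_neg (not_not.2 hsq)]
    set s₁ : ℝ := (#((Nat.divisors m).filter (fun d : ℕ => d.Prime ∧ (d : ℝ) ≤ D)) : ℝ) with hs₁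
    set s₂ : ℝ := (#((Nat.divisors m).filter (fun d : ℕ => Ω d = 2 ∧ (d : ℝ) ≤ D)) : ℝ) with hs₂
    have hs₁le : s₁ ≤ Ω m := by rw [hs₁]; exact_mod_cast card_filter_prime_divisors_le hsq D
    have hs₂0 : 0 ≤ s₂ := by rw [hs₂]; exact Nat.cast_nonneg _
    have hΩ1 : 1 ≤ Ω m := by
      rw [← card_primeFactors_eq_cardFactors hsq, Finset.one_le_card]
      exact ⟨m.minFac, Nat.mem_primeFactors.2 ⟨Nat.minFac_prime (by omega), Nat.minFac_dvd m, hm0⟩⟩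
    interval_cases hΩm : Ω m
    · -- `Ω = 1`: `m` prime, `s₁ = s₂ = 0`
      have hp : m.Prime := ArithmeticFunction.cardFactors_eq_one_iff_prime.1 hΩm
      have e1 : s₁ = 0 := by
        rw [hs₁, card_filter_prime_divisors_eq m, Nat.Prime.primeFactors hp]
        norm_cast
        rw [Finset.card_eq_zero, Finset.filter_eq_empty_iff]
        intro r hr hle; rw [Finset.mem_singleton] at hr; subst hr; linarith
      have e2 : s₂ = 0 := by
        rw [hs₂]; norm_cast
        rw [Finset.card_eq_zero, Finset.filter_eq_empty_iff]
        rintro d hd ⟨hΩd, -⟩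
        have := cardFactors_le_of_dvd hm0 (Nat.dvd_of_mem_divisors hd); omega
      simp only [if_pos hp, e1, e2]
      norm_num
    · -- `Ω = 2`
      have hnp : ¬ m.Prime := fun h => by
        have := ArithmeticFunction.cardFactors_apply_prime h; omega
      have e2 : s₂ = 0 := by
        rw [hs₂]; exact_mod_cast card_filter_two_divisors_eq_zero hm0 hΩm hDm'
      have e1 : s₁ = if (m.minFac : ℝ) ≤ D then 1 else 0 := by
        rw [hs₁]; exact_mod_cast card_filter_prime_divisors_of_two hsq hΩm (by linarith) hDm
      rw [if_neg hnp, e2, e1]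
      by_cases hmf : (m.minFac : ℝ) ≤ D
      · rw [if_pos hmf, if_neg (fun h => not_lt.2 hmf h.1)]; norm_num
      · rw [if_neg hmf, if_pos ⟨not_le.1 hmf, rfl⟩]; norm_num
    · -- `Ω = 3`
      have hnp : ¬ m.Prime := fun h => by
        have := ArithmeticFunction.cardFactors_apply_prime h; omega
      rw [if_neg hnp]
      norm_num at hs₁le ⊢
      nlinarith
    · -- `Ω = 4`
      have hnp : ¬ m.Prime := fun h => by
        have := ArithmeticFunction.cardFactors_apply_prime h; omega
      have e1 : s₁ = 4 := by
        rw [hs₁]; exact_mod_cast (card_filter_prime_divisors_eq_cardFactors hsq (h4 rfl)).trans hΩm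
      have e2 : s₂ ≤ 3 := by
        rw [hs₂]; exact_mod_cast card_filter_two_divisors_le_three hsq hΩm (by linarith) hDm
      rw [if_neg hnp, e1]
      norm_num
      linarith
    · -- `Ω = 5`
      have hnp : ¬ m.Prime := fun h => by
        have := ArithmeticFunction.cardFactors_apply_prime h; omega
      have e1 : s₁ ≤ 5 := by norm_num at hs₁le; exact hs₁le
      have e2 : 4 ≤ s₂ := by
        rw [hs₂]
        have hall : (Nat.divisors m).filter (fun d : ℕ => Ω d = 2 ∧ (d : ℝ) ≤ D) =
            (Nat.divisors m).filter (fun d : ℕ => Ω d = 2) :=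
          Finset.filter_congr fun d hd => ⟨fun h => h.1, fun h => ⟨h, h5 rfl d hd h⟩⟩
        rw [hall]; exact_mod_cast four_le_card_filter_two_divisors hsq hΩm
      rw [if_neg hnp]
      norm_num
      linarith
  · -- not squarefree: `|G| ≤ 2^Ω ≤ 32`
    have hnp : ¬ m.Prime := fun h => hsq h.squarefree
    rw [if_neg hnp, if_pos hsq]
    have hG := abs_truncMoebius_le hm0 D
    have h32 : (2 : ℝ) ^ Ω m ≤ 32 := by
      calc (2 : ℝ) ^ Ω m ≤ 2 ^ 5 := pow_le_pow_right₀ (by norm_num) hΩ5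
        _ = 32 := by norm_num
    have hlam1 : |(ArithmeticFunction.liouville m : ℝ)| = 1 := by
      rw [hlam, abs_pow, abs_neg, abs_one, one_pow]
    have hprod : |(ArithmeticFunction.liouville m : ℝ) *
        ∑ d ∈ (Nat.divisors m).filter (fun d : ℕ => (d : ℝ) ≤ D), (μ d : ℝ)| ≤ 32 := by
      rw [abs_mul, hlam1, one_mul]; exact hG.trans h32
    have h1 := (abs_le.1 hprod).2
    have : (0 : ℝ) ≤ (if D < (m.minFac : ℝ) ∧ Ω m = 2 then 1 else 0) := by positivity
    have : (0 : ℝ) ≤ (if Ω m = 3 then (1 : ℝ) else 0) := by positivity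
    linarith

/-! ### Size lemmas on rough integers -/

/-- A `y`-rough `m < y⁶` has `Ω(m) ≤ 5`. -/
theorem cardFactors_le_five_of_rough {m : ℕ} {y : ℝ} (hm0 : m ≠ 0) (hy : 1 ≤ y)
    (hr : ∀ p ∈ m.primeFactors, y ≤ (p : ℝ)) (hm : (m : ℝ) < y ^ 6) : Ω m ≤ 5 := by
  by_contra h
  push Not at h
  have h1 : ⌈y⌉₊ ^ Ω m ≤ m := pow_cardFactors_le_of_rough hm0
    (fun p hp hpm => Nat.ceil_le.2 (hr p (Nat.mem_primeFactors.2 ⟨hp, hpm, hm0⟩)))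
  have hc1 : 1 ≤ ⌈y⌉₊ := Nat.one_le_ceil_iff.2 (by linarith)
  have h2 : ⌈y⌉₊ ^ 6 ≤ ⌈y⌉₊ ^ Ω m := Nat.pow_le_pow_right hc1 (by omega)
  have h3 : y ^ 6 ≤ ((⌈y⌉₊ ^ 6 : ℕ) : ℝ) := by
    push_cast; exact pow_le_pow_left₀ (by linarith) (Nat.le_ceil y) 6
  have h4 : ((⌈y⌉₊ ^ 6 : ℕ) : ℝ) ≤ (m : ℝ) := by exact_mod_cast h2.trans h1
  linarith

/-- If `d ∣ m`, `m` is `y`-rough, `Ω(m/d) = 3` and `m ≤ D·y³`, then `d ≤ D`. -/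
theorem le_of_cofactor_three {m d : ℕ} {y D : ℝ} (hm0 : m ≠ 0) (hy : 0 < y) (hd : d ∣ m)
    (hr : ∀ p ∈ m.primeFactors, y ≤ (p : ℝ)) (hΩ : Ω (m / d) = 3) (hm : (m : ℝ) ≤ D * y ^ 3) :
    (d : ℝ) ≤ D := by
  have hk0 : m / d ≠ 0 := by
    intro h; rw [h] at hΩ; simp at hΩ
  have hrk : ∀ p ∈ (m / d).primeFactors, y ≤ (p : ℝ) := rough_of_dvd hr hm0 (Nat.div_dvd_of_dvd hd)
  have h1 : ⌈y⌉₊ ^ Ω (m / d) ≤ m / d := pow_cardFactors_le_of_rough hk0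
    (fun p hp hpm => Nat.ceil_le.2 (hrk p (Nat.mem_primeFactors.2 ⟨hp, hpm, hk0⟩)))
  rw [hΩ] at h1
  have h2 : d * ⌈y⌉₊ ^ 3 ≤ m := by
    calc d * ⌈y⌉₊ ^ 3 ≤ d * (m / d) := Nat.mul_le_mul_left d h1
      _ = m := Nat.mul_div_cancel' hd
  have h3 : (d : ℝ) * y ^ 3 ≤ (d : ℝ) * ((⌈y⌉₊ : ℕ) : ℝ) ^ 3 :=
    mul_le_mul_of_nonneg_left (pow_le_pow_left₀ hy.le (Nat.le_ceil y) 3) (Nat.cast_nonneg d)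
  have h4 : (d : ℝ) * ((⌈y⌉₊ : ℕ) : ℝ) ^ 3 ≤ (m : ℝ) := by exact_mod_cast h2
  exact le_of_mul_le_mul_right (h3.trans (h4.trans hm)) (pow_pos hy 3)

end Summit.Parity.GeneralizedHardyLittlewood.Theorems.ParityLeakOneFifth
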